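import Summits.CriticalPhenomena.PercolationContinuityZ3.Theorems.PercNearOneGluingNoHeavyLowerTailKnQuestion8CoefficientwiseCoreClassKernelMixHubMinSide
import HarnessLib

/-!
# μ₁ is an involution of the whole family 𝒱 (PATH LEMMA of hub-Kleitman, layer 3)

Support file (`--supports stmt-CriticalPhenomena-4575`, closed), prover `prim-cplus-coupling` (gen 51).  No definitions, no notations,
no named facts, no sorries; standard axioms.  Memo `prim-cplus-coupling/A5-COUPLING-gen51.md` §2 (Lemma 2.3).

Assembly of `…KernelMixHubMinSide`: the family `𝒱 = 𝔉 ∪ 𝒪` of the augmented staircase theorem (hypothesis style, see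
that file) and the min-side toggle `t₁` (toggle `0` on 0-sets and on inner sets with cell in `A`; the row threshold
`θ(max X)` on the other inner sets; `beta (max (X∖N))` on N-sets; `∅ ↦ {0}` or `{dA+1}`).
`hubStair_mu1_invol`: for `X ∈ 𝒱`, `X ∆ {t₁ X} ∈ 𝒱`, `t₁ (X ∆ {t₁ X}) = t₁ X`, and `t₁ X ≤ e` for every `e ∈ X`.
[cite: KozmaNitzan2024, Questions 8–9 (§5.5 p. 36) (context)]
-/

namespace Summit.CriticalPhenomena.PercolationContinuityZ3.Theorems

open Finset
open scoped symmDiff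

namespace Coefficientwise

/-- **μ₁ is an involution of 𝒱** (memo §2.3; min side of the augmented staircase theorem). [folklore] -/
theorem hubStair_mu1_invol (N : ℕ) (hN : 2 ≤ N)
    (xi alpha beta : ℕ → ℕ) (sA dA bd db : ℕ) (A B : Finset (ℕ × ℕ))
    (hxi : ∀ y, 1 ≤ y → y ≤ N - 1 → 1 ≤ xi y ∧ xi y ≤ y)
    (hxi2 : ∀ y, 2 ≤ y → y ≤ N - 1 → xi y ≤ y - 1)
    (hArow : ∀ x y, (x, y) ∈ A ↔ 1 ≤ x ∧ x ≤ y ∧ y ≤ N - 1 ∧ x ≤ alpha y)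
    (hAR : ∀ x y, (x, y) ∈ A → xi y ≤ x)
    (hAdiag : ∀ x, (x, x) ∈ A ↔ 1 ≤ x ∧ x ≤ sA)
    (hAdom : ∀ x, (x, x + 1) ∈ A ↔ 1 ≤ x ∧ x ≤ dA)
    (hsd : dA ≤ sA ∧ sA ≤ dA + 1) (hdN : dA + 1 ≤ N - 1)
    (hBrow : ∀ x y, (x, y) ∈ B ↔ 1 ≤ x ∧ x ≤ y ∧ y ≤ N - 1 ∧ beta y ≤ x)
    (hBdiag : ∀ x, (x, x) ∈ B ↔ 1 ≤ x ∧ bd ≤ x ∧ x ≤ N - 1)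
    (hBdom : ∀ x, (x, x + 1) ∈ B ↔ 1 ≤ x ∧ db ≤ x ∧ x + 1 ≤ N - 1)
    (hbd : db ≤ bd ∧ bd ≤ db + 1) (hbd1 : 1 ≤ db) (hdbN : db ≤ N - 1)
    (hbeta1 : ∀ y, 1 ≤ beta y)
    (V : Finset ℕ → Prop)
    (hV : ∀ X, V X ↔
      (X = ∅ ∨
      (X.Nonempty ∧ 0 ∉ X ∧ N ∉ X ∧ (∀ e ∈ X, e ≤ N - 1) ∧ ∀ h : X.Nonempty, xi (X.max' h) ≤ X.min' h) ∨
      (0 ∈ X ∧ N ∉ X ∧ (∀ e ∈ X, e ≤ N - 1) ∧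
        ((X = {0} ∧ sA = dA + 1) ∨ ∃ h : (X.erase 0).Nonempty, ((X.erase 0).min' h, (X.erase 0).max' h) ∈ A)) ∨
      (N ∈ X ∧ 0 ∉ X ∧ (∀ e ∈ X, e ≤ N) ∧
        ((X = {N} ∧ bd = db) ∨ ∃ h : (X.erase N).Nonempty, ((X.erase N).min' h, (X.erase N).max' h) ∈ B))))
    (t₁ : Finset ℕ → ℕ)
    (ht₁ : ∀ X, t₁ X =
      if 0 ∈ X then 0
      else if N ∈ X then (if h : (X.erase N).Nonempty then beta ((X.erase N).max' h) else bd)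
      else if h : X.Nonempty then
        (if (X.min' h, X.max' h) ∈ A then 0 else max (xi (X.max' h)) (alpha (X.max' h) + 1))
      else (if sA = dA + 1 then 0 else dA + 1))
    (X : Finset ℕ) (hX : V X) :
    V (X ∆ {t₁ X}) ∧ t₁ (X ∆ {t₁ X}) = t₁ X ∧ ∀ e ∈ X, t₁ X ≤ e := by
  classical
  have hN1 : 1 ≤ N - 1 := by omega
  have hNlt : N - 1 < N := by omega
  -- the inner-part toggle `a` and the top-part toggle `c`
  obtain ⟨a, ha⟩ : ∃ a : Finset ℕ → ℕ, ∀ Y : Finset ℕ,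
      a Y = if h : Y.Nonempty then max (xi (Y.max' h)) (alpha (Y.max' h) + 1) else dA + 1 := ⟨_, fun _ => rfl⟩
  obtain ⟨c, hc⟩ : ∃ c : Finset ℕ → ℕ, ∀ Y : Finset ℕ,
      c Y = if h : (Y.erase N).Nonempty then beta ((Y.erase N).max' h) else bd := ⟨_, fun _ => rfl⟩
  -- part (b) sets are in 𝒱 and t₁ = a there
  have hPartB : ∀ Y : Finset ℕ,
      ((Y = ∅ ∧ sA = dA) ∨ (Y.Nonempty ∧ (∀ e ∈ Y, 1 ≤ e ∧ e ≤ N - 1) ∧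
        ∀ h : Y.Nonempty, max (xi (Y.max' h)) (alpha (Y.max' h) + 1) ≤ Y.min' h)) →
      V Y ∧ t₁ Y = a Y := by
    intro Y hY
    rcases hY with ⟨rfl, hs⟩ | ⟨hne, hbd', hθ⟩
    · refine ⟨(hV _).mpr (Or.inl rfl), ?_⟩
      rw [ht₁, ha]
      have hs' : ¬ sA = dA + 1 := by omega
      simp [hs']
    · have h0 : (0 : ℕ) ∉ Y := fun h => by have := (hbd' 0 h).1; omega
      have hNn : N ∉ Y := fun h => by have := (hbd' N h).2; omega
      have hcell : (Y.min' hne, Y.max' hne) ∉ A := by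
        intro hin
        have := ((hArow _ _).mp hin).2.2.2
        have := hθ hne
        omega
      refine ⟨(hV _).mpr (Or.inr (Or.inl ⟨hne, h0, hNn, fun e he => (hbd' e he).2, fun h => ?_⟩)), ?_⟩
      · have := hθ h
        have hh : h = hne := rfl
        omega
      · rw [ht₁, ha, if_neg h0, if_neg hNn, dif_pos hne, dif_pos hne, if_neg hcell]
  rw [hV] at hX
  rcases hX with rfl | ⟨hne, h0, hNn, hle, hR⟩ | ⟨h0, hNn, hle, hrest⟩ | ⟨hNX, h0, hle, hrest⟩
  · ----------------------------------------------------------------- X = ∅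
    by_cases hε : sA = dA + 1
    · have ht : t₁ ∅ = 0 := by rw [ht₁]; simp [hε]
      rw [ht]
      have hY : (∅ : Finset ℕ) ∆ {0} = {0} := by simp
      rw [hY]
      refine ⟨(hV _).mpr (Or.inr (Or.inr (Or.inl ⟨by simp, by simp; omega, by simp, Or.inl ⟨rfl, hε⟩⟩))), ?_,
        by simp⟩
      rw [ht₁]; simp
    · have hs : sA = dA := by omega
      have hb := hPartB ∅ (Or.inl ⟨rfl, hs⟩)
      obtain ⟨hmem, haa, hle'⟩ := hubStair_mu1_innerPart N xi alpha sA dA A hxi hxi2 hArow hAdiag hAdom hsd hdN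
        a ha ∅ (Or.inl ⟨rfl, hs⟩)
      have hb2 := hPartB _ hmem
      rw [hb.2]
      exact ⟨hb2.1, by rw [hb2.2, haa], hle'⟩
  · ----------------------------------------------------------------- inner X
    have hmin1 : 1 ≤ X.min' hne := by
      rcases Nat.eq_zero_or_pos (X.min' hne) with h | h
      · exact absurd (h ▸ min'_mem X hne) h0
      · exact h
    by_cases hcA : (X.min' hne, X.max' hne) ∈ A
    · -- toggle 0
      have ht : t₁ X = 0 := by rw [ht₁, if_neg h0, if_neg hNn, dif_pos hne, if_pos hcA]
      rw [ht, hub_symmDiff_singleton_eq_insert X 0 h0]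
      refine ⟨(hV _).mpr (Or.inr (Or.inr (Or.inl ⟨mem_insert_self 0 X, ?_, ?_, Or.inr ?_⟩))), ?_,
        fun e _ => Nat.zero_le e⟩
      · rw [mem_insert]; push Not; exact ⟨by omega, hNn⟩
      · intro e he
        rcases mem_insert.mp he with rfl | he
        · omega
        · exact hle e he
      · rw [erase_insert h0]; exact ⟨hne, hcA⟩
      · rw [ht₁, if_pos (mem_insert_self 0 X)]
    · -- part (b)
      have hbd' : ∀ e ∈ X, 1 ≤ e ∧ e ≤ N - 1 := fun e he =>
        ⟨hmin1.trans (min'_le X e he), hle e he⟩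
      have hθ : ∀ h : X.Nonempty, max (xi (X.max' h)) (alpha (X.max' h) + 1) ≤ X.min' h := by
        intro h
        have hh : h = hne := rfl
        rw [hh]
        have h1 := hR hne
        have h2 : ¬ (X.min' hne ≤ alpha (X.max' hne)) := by
          intro hle2
          apply hcA
          rw [hArow]
          exact ⟨hmin1, min'_le X _ (max'_mem X hne), hle _ (max'_mem X hne), hle2⟩
        omega
      have hb := hPartB X (Or.inr ⟨hne, hbd', hθ⟩)
      obtain ⟨hmem, haa, hle'⟩ := hubStair_mu1_innerPart N xi alpha sA dA A hxi hxi2 hArow hAdiag hAdom hsd hdN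
        a ha X (Or.inr ⟨hne, hbd', hθ⟩)
      have hb2 := hPartB _ hmem
      rw [hb.2]
      exact ⟨hb2.1, by rw [hb2.2, haa], hle'⟩
  · ----------------------------------------------------------------- 0 ∈ X
    have ht : t₁ X = 0 := by rw [ht₁, if_pos h0]
    rw [ht, hub_symmDiff_singleton_eq_erase X 0 h0]
    refine ⟨?_, ?_, fun e _ => Nat.zero_le e⟩
    · rcases hrest with ⟨hX0, hε⟩ | ⟨hZne, hcell⟩
      · rw [hX0]; simp only [erase_singleton]
        exact (hV _).mpr (Or.inl rfl)
      · refine (hV _).mpr (Or.inr (Or.inl ⟨hZne, fun h => (mem_erase.mp h).1 rfl,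
          fun h => hNn (mem_of_mem_erase h), fun e he => hle e (mem_of_mem_erase he), fun h => ?_⟩))
        have hh : h = hZne := rfl
        rw [hh]
        exact hAR _ _ hcell
    · rcases hrest with ⟨hX0, hε⟩ | ⟨hZne, hcell⟩
      · rw [hX0]; simp only [erase_singleton]
        rw [ht₁]; simp [hε]
      · have h0' : (0 : ℕ) ∉ X.erase 0 := fun h => (mem_erase.mp h).1 rfl
        have hN' : N ∉ X.erase 0 := fun h => hNn (mem_of_mem_erase h)
        rw [ht₁, if_neg h0', if_neg hN', dif_pos hZne, if_pos hcell]
  · ----------------------------------------------------------------- N ∈ X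
    have ht : t₁ X = c X := by rw [ht₁, hc, if_neg h0, if_pos hNX]
    obtain ⟨⟨hNY, hleY, hrestY⟩, hcc, hcle⟩ := hubStair_mu1_topPart N hN beta bd db B hBrow hBdiag hBdom hbd hbd1
      hdbN hbeta1 c hc X ⟨hNX, hle, hrest⟩
    rw [ht]
    -- the toggled element is ≥ 1, so 0 stays outside
    have hc1 : 1 ≤ c X := by
      rw [hc]; split_ifs
      · exact hbeta1 _
      · omega
    have h0Y : (0 : ℕ) ∉ X ∆ {c X} := by
      rw [mem_symmDiff, mem_singleton]
      rintro (⟨h, _⟩ | ⟨h, _⟩)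
      · exact h0 h
      · omega
    refine ⟨(hV _).mpr (Or.inr (Or.inr (Or.inr ⟨hNY, h0Y, hleY, hrestY⟩))), ?_, hcle⟩
    rw [ht₁, if_neg h0Y, if_pos hNY, ← hc]
    exact hcc

end Coefficientwise

end Summit.CriticalPhenomena.PercolationContinuityZ3.Theorems
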